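import Literature.Probability.Percolation.SharpnessDCTProofs
import Literature.Probability.Percolation.SeedLemma
import Summits.CriticalPhenomena.PercolationContinuityZ3.Theorems.PercNearOneGluingNoHeavyLowerTailStarBadFibre
import Mathlib

/-!
# Crux `PercNearOneGluing.NoHeavyLowerTail` (stmt-CriticalPhenomena-4575), line
`bhk-superadditivity-thinning` — stub `starUnrelFibre` (fibre identity for the true budget of a
relay point of the star)

Helper file for the crux skeleton (lead prover-line-stmt-CriticalPhenomena-4575-c3-0): proves
exactly the registered stub signature `starUnrelFibre`; lands with
`--supports stmt-CriticalPhenomena-4575`.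

## Content

Weighted complete graph on `Fin n`, a hub `o ∉ A`, a target `b ∈ A`, a relay point `a₀ ∈ A`, and
a fixed pattern `η` of open pairs *not containing `o`*.  The pairs at `o` towards `A` are opened
independently, the pair `s(o, a)` with probability `q a = w s(o, a)`; the opened set `S ⊆ A` has
weight `PA S = (∏_{a ∈ S} q a) (∏_{a ∈ A \ S} (1 - q a))` and produces the configuration
`ω(S, η) = {s(o, a) : a ∈ S} ∪ η`.  Write `x ~ y` for "`x ↔ y` by an open path of `η` avoiding
`o`" (`openConnIn {o}ᶜ x y`, an event of `η` alone), `L = {a ∈ A | a ~ b}` (alive points) and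
`C = {a ∈ A | a₀ ~ a}` (the block of `a₀`), and `Π_X = ∏_{a ∈ A} (1{a ∈ X} (1 - q a) + 1{a ∉ X})`.
Then

`Σ_{S ⊆ A} PA S · 1{ω(S, η) ∉ {a₀ ↔ b}} = 1{a₀ ∉ L} (Π_C + Π_L - Π_C Π_L)`,

i.e. given `η`, the relay point `a₀` fails to be joined to `b` with conditional probability
`0` if `a₀ ~ b`, and otherwise with the probability that no coin of its block is open or no alive
coin is open.

## Proof

* Graph fact (`starUF_openConn_iff`): in `ω(S, η)`, `a₀ ↔ b` iff `a₀ ~ b`, or some `a'' ∈ S`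
  lies in the block of `a₀` and some `a' ∈ S` is alive (the path then runs
  `a₀ ~ a'' — o — a' ~ b`).  Indeed an open path `a₀ → b` either avoids `o`, and then only uses
  pairs of `η`, or visits `o`, and then `o ↔ a₀` and `o ↔ b`, which by `starBF_openConn_iff`
  (the star sees `{o}ᶜ` only through its tips) means exactly the displayed condition.
* Cases: if `a₀ ~ b` every summand vanishes.  Otherwise `C ∩ L = ∅` (transitivity of `~`,
  `GM.openConnIn_trans`) and
  `1{a₀ ↮ b} = 1{S ∩ C = ∅} + 1{S ∩ L = ∅} - 1{S ∩ (C ∪ L) = ∅}`; the coin sums are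
  `Π_C`, `Π_L`, `Π_{C ∪ L} = Π_C Π_L` (`starBF_coinExpansion_disjoint`).
-/

open scoped Classical

namespace Summit.CriticalPhenomena.PercolationContinuityZ3.Theorems

open Literature.Probability.Percolation

section StarUnrelFibreAux

variable {n : ℕ}

/-- **A connection of the star configuration either avoids the hub or passes through it.**  Let
`ω = {s(o, a) : a ∈ S} ∪ η` and `x ≠ o`.  If `x ↔ y` in `ω`, then either `x ↔ y` in `η` by an
open path avoiding `o` (the first-exit decomposition of the path at `{o}ᶜ` finds no exit, and away
from `o` the open pairs of `ω` are pairs of `η`), or the path visits `o`, and then `o ↔ x` and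
`o ↔ y` in `ω`. [folklore] -/
theorem starUF_avoid_or_through {o x y : Fin n} {S : Finset (Fin n)}
    {η : Finset (Sym2 (Fin n))} (hx : x ≠ o)
    (h : ((↑(S.image (fun a => s(o, a))) ∪ ↑η : Set (Sym2 (Fin n))) ∈
        (openConn x y : Set (BondConfig (Fin n))))) :
    (↑η : Set (Sym2 (Fin n))) ∈ openConnIn (({o} : Set (Fin n))ᶜ) x y ∨
      (((↑(S.image (fun a => s(o, a))) ∪ ↑η : Set (Sym2 (Fin n))) ∈
          (openConn o x : Set (BondConfig (Fin n)))) ∧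
        ((↑(S.image (fun a => s(o, a))) ∪ ↑η : Set (Sym2 (Fin n))) ∈
          (openConn o y : Set (BondConfig (Fin n))))) := by
  set ω : BondConfig (Fin n) := (↑(S.image (fun a => s(o, a))) ∪ ↑η : Set (Sym2 (Fin n))) with hω
  have hp : PathIn (openGraph ω) Set.univ x y := DCT16.pathIn_univ_of_reachable h
  have hxc : x ∈ (({o} : Set (Fin n))ᶜ) := by
    simpa only [Set.mem_compl_iff, Set.mem_singleton_iff] using hx
  rcases hp.exit_or (R := (({o} : Set (Fin n))ᶜ)) hxc with hp' | ⟨a, c, -, hc, -, hac, hpa⟩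
  · left
    rw [Set.inter_univ] at hp'
    refine DCT16.mem_openConnIn_of_pathIn ?_
    refine DCT16.pathIn_congrGraph (fun u v hu hv huv => ?_) hp'
    rw [openGraph_adj] at huv ⊢
    refine ⟨?_, huv.2⟩
    rcases huv.1 with h1 | h1
    · obtain ⟨a'', -, he''⟩ := Finset.mem_image.1 h1
      have ho : o ∈ s(u, v) := by rw [← he'']; exact Sym2.mem_mk_left o a''
      rcases Sym2.mem_iff.1 ho with h2 | h2
      · exact absurd h2.symm hu
      · exact absurd h2.symm hv
    · exact h1
  · right
    have hco : c = o := by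
      simpa only [Set.mem_compl_iff, Set.mem_singleton_iff, not_not] using hc
    rw [Set.inter_univ] at hpa
    have hxo : (openGraph ω).Reachable x o := by
      rw [← hco]; exact (DCT16.reachable_of_pathIn hpa).trans hac.reachable
    have hxy : (openGraph ω).Reachable x y := h
    exact ⟨hxo.symm, hxo.symm.trans hxy⟩

/-- **When is the relay point joined to the target?**  Let `ω = {s(o, a) : a ∈ S} ∪ η` with
`o ∉ S`, no pair of `η` containing `o`, and `x, y ≠ o`.  Then `x ↔ y` in `ω` iff either `x ~ y`
(joined in `η` avoiding `o`), or some `a ∈ S` has `x ~ a` and some `a' ∈ S` has `a' ~ y`: a path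
through `o` enters and leaves `o` through two star pairs `s(o, a)`, `s(o, a')` with `a, a' ∈ S`
(`starBF_openConn_iff` applied to both halves), and conversely `x ~ a — o — a' ~ y` is an open
path of `ω`. [folklore] -/
theorem starUF_openConn_iff {o x y : Fin n} {S : Finset (Fin n)} (hoS : o ∉ S)
    {η : Finset (Sym2 (Fin n))} (hη : ∀ e ∈ η, o ∉ e) (hx : x ≠ o) (hy : y ≠ o) :
    ((↑(S.image (fun a => s(o, a))) ∪ ↑η : Set (Sym2 (Fin n))) ∈
        (openConn x y : Set (BondConfig (Fin n)))) ↔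
      ((↑η : Set (Sym2 (Fin n))) ∈ openConnIn (({o} : Set (Fin n))ᶜ) x y ∨
        ((∃ a ∈ S, (↑η : Set (Sym2 (Fin n))) ∈ openConnIn (({o} : Set (Fin n))ᶜ) x a) ∧
          (∃ a ∈ S, (↑η : Set (Sym2 (Fin n))) ∈ openConnIn (({o} : Set (Fin n))ᶜ) a y))) := by
  set ω : BondConfig (Fin n) := (↑(S.image (fun a => s(o, a))) ∪ ↑η : Set (Sym2 (Fin n))) with hω
  constructor
  · intro h
    rcases starUF_avoid_or_through hx h with h' | ⟨hox, hoy⟩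
    · exact Or.inl h'
    · refine Or.inr ⟨?_, (starBF_openConn_iff hoS hη hy).1 hoy⟩
      obtain ⟨a, haS, ha⟩ := (starBF_openConn_iff hoS hη hx).1 hox
      exact ⟨a, haS, GM.openConnIn_comm.1 ha⟩
  · rintro (h | ⟨⟨a, haS, ha⟩, ⟨a', ha'S, ha'⟩⟩)
    · have hp : PathIn (openGraph (↑η : Set (Sym2 (Fin n)))) (({o} : Set (Fin n))ᶜ) x y :=
        DCT16.pathIn_of_mem_openConnIn h
      have hp' : PathIn (openGraph ω) (({o} : Set (Fin n))ᶜ) x y :=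
        hp.mono_graph (SimpleGraph.fromEdgeSet_mono Set.subset_union_right)
      exact DCT16.reachable_of_pathIn hp'
    · have hox : (openGraph ω).Reachable o x :=
        (starBF_openConn_iff hoS hη hx).2 ⟨a, haS, GM.openConnIn_comm.1 ha⟩
      have hoy : (openGraph ω).Reachable o y :=
        (starBF_openConn_iff hoS hη hy).2 ⟨a', ha'S, ha'⟩
      exact hox.symm.trans hoy

end StarUnrelFibreAux

/-- **Fibre identity for the true budget of a relay point of the star** (registered stub
`starUnrelFibre` of crux stmt-CriticalPhenomena-4575, line bhk-superadditivity-thinning).  Hub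
`o ∉ A`, target `b ∈ A`, relay point `a₀ ∈ A`, pattern `η` of open pairs off `o`, coins
`q a = w s(o, a)` on the pairs from `o` to `A` with pattern law
`PA S = (∏_{a ∈ S} q a) (∏_{a ∈ A \ S} (1 - q a))`, configuration `ω(S, η) = {s(o, a) : a ∈ S} ∪ η`,
`L = {a ∈ A | a ↔ b avoiding o in η}`, `C = {a ∈ A | a₀ ↔ a avoiding o in η}` and
`Π_X = ∏_{a ∈ A} (1{a ∈ X} (1 - q a) + 1{a ∉ X})`:
`Σ_{S ⊆ A} PA S · 1{ω(S, η) ∉ {a₀ ↔ b}} = 1{a₀ ∉ L} (Π_C + Π_L - Π_C Π_L)`.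
Proof: by `starUF_openConn_iff`, `a₀ ↔ b` in `ω(S, η)` iff `a₀ ∈ L` or (`S ∩ C ≠ ∅` and
`S ∩ L ≠ ∅`); if `a₀ ∉ L` then `C ∩ L = ∅`, the indicator is
`1{S ∩ C = ∅} + 1{S ∩ L = ∅} - 1{S ∩ (C ∪ L) = ∅}`, and the three coin sums are `Π_C`, `Π_L`,
`Π_{C ∪ L} = Π_C Π_L` (`starBF_coinExpansion_disjoint`). -/
theorem starUnrelFibre : ∀ (n : ℕ) (w : Sym2 (Fin n) → unitInterval) (A : Finset (Fin n)) (o b a₀ : Fin n) (η : Finset (Sym2 (Fin n))), o ∉ A → b ∈ A → a₀ ∈ A → (∀ e ∈ η, o ∉ e) → ∑ S ∈ A.powerset, ((∏ a ∈ S, ((w s(o, a) : unitInterval) : ℝ)) * ∏ a ∈ A \ S, (1 - ((w s(o, a) : unitInterval) : ℝ))) * (if ((↑(S.image (fun a => s(o, a))) ∪ ↑η : Set (Sym2 (Fin n))) ∈ ((Literature.Probability.Percolation.openConn a₀ b)ᶜ : Set (Literature.Probability.Percolation.BondConfig (Fin n)))) then (1 : ℝ) else 0) = (if a₀ ∈ A.filter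 (fun a' => (↑η : Set (Sym2 (Fin n))) ∈ Literature.Probability.Percolation.openConnIn (({o} : Set (Fin n))ᶜ) a' b) then (0 : ℝ) else ((∏ a ∈ A, (if a ∈ A.filter (fun a' => (↑η : Set (Sym2 (Fin n))) ∈ Literature.Probability.Percolation.openConnIn (({o} : Set (Fin n))ᶜ) a₀ a') then (1 : ℝ) - ((w s(o, a) : unitInterval) : ℝ) else 1)) + (∏ a ∈ A, (if a ∈ A.filter (fun a' => (↑η : Set (Sym2 (Fin n))) ∈ Literature.Probability.Percolation.openConnIn (({o} : Set (Fin n))ᶜ) a' b) then (1 : ℝ) - ((w s(o, a) : unitInterval) : ℝ) else 1)) - (∏ a ∈ A, (if a ∈ A.filter (fun a' => (↑η : Set (Sym2 (Fin n))) ∈ Literature.Probability.Percolation.openConnIn (({o} : Set (Fin n))ᶜ) a₀ a') then (1 : ℝ) - ((w s(o, a) : unitInterval) : ℝ) else 1)) * (∏ a ∈ A, (if a ∈ A.filter (fun a' => (↑η : Set (Sym2 (Fin n))) ∈ Literature.Probability.Percolation.openConnIn (({o} : Set (Fin n))ᶜ) a' b) then (1 : ℝ) - ((w s(o, a) : unitInterval)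 : ℝ) else 1)))) := by
  intro n w A o b a₀ η hoA hbA ha₀A hη
  have hbo : b ≠ o := fun h => hoA (h ▸ hbA)
  have ha₀o : a₀ ≠ o := fun h => hoA (h ▸ ha₀A)
  set L : Finset (Fin n) :=
    A.filter (fun a' => (↑η : Set (Sym2 (Fin n))) ∈ openConnIn (({o} : Set (Fin n))ᶜ) a' b) with hL
  set C : Finset (Fin n) :=
    A.filter (fun a' => (↑η : Set (Sym2 (Fin n))) ∈ openConnIn (({o} : Set (Fin n))ᶜ) a₀ a') with hC
  set q : Fin n → ℝ := fun a => ((w s(o, a) : unitInterval) : ℝ) with hq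
  by_cases hab : (↑η : Set (Sym2 (Fin n))) ∈ openConnIn (({o} : Set (Fin n))ᶜ) a₀ b
  · -- the relay point is alive: every summand vanishes
    rw [if_pos (Finset.mem_filter.2 ⟨ha₀A, hab⟩)]
    refine Finset.sum_eq_zero (fun S hS => ?_)
    have hSA : S ⊆ A := Finset.mem_powerset.1 hS
    have hoS : o ∉ S := fun h => hoA (hSA h)
    rw [if_neg (Set.notMem_compl_iff.2 ((starUF_openConn_iff hoS hη ha₀o hbo).2 (Or.inl hab))),
      mul_zero]
  · rw [if_neg (show a₀ ∉ L from fun h => hab (Finset.mem_filter.1 h).2)]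
    -- the block of `a₀` and the alive set are disjoint
    have hCL : ∀ a, ¬ (a ∈ C ∧ a ∈ L) := fun a h =>
      hab (GM.openConnIn_trans (Finset.mem_filter.1 h.1).2 (Finset.mem_filter.1 h.2).2)
    -- Step 1: the indicator on the fibre is `1{S ∩ C = ∅} + 1{S ∩ L = ∅} - 1{S ∩ (C ∪ L) = ∅}`.
    have hsum : ∑ S ∈ A.powerset, ((∏ a ∈ S, q a) * ∏ a ∈ A \ S, (1 - q a)) *
          (if ((↑(S.image (fun a => s(o, a))) ∪ ↑η : Set (Sym2 (Fin n))) ∈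
              ((openConn a₀ b)ᶜ : Set (BondConfig (Fin n))))
            then (1 : ℝ) else 0)
        = ∑ S ∈ A.powerset,
          (((if Disjoint S C then (∏ a ∈ S, q a) * ∏ a ∈ A \ S, (1 - q a) else 0)
            + (if Disjoint S L then (∏ a ∈ S, q a) * ∏ a ∈ A \ S, (1 - q a) else 0))
            - (if Disjoint S (C ∪ L) then (∏ a ∈ S, q a) * ∏ a ∈ A \ S, (1 - q a) else 0)) := by
      refine Finset.sum_congr rfl (fun S hS => ?_)
      have hSA : S ⊆ A := Finset.mem_powerset.1 hS
      have hoS : o ∉ S := fun h => hoA (hSA h)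
      have hiff := starUF_openConn_iff (x := a₀) (y := b) hoS hη ha₀o hbo
      have hSC : (∃ a ∈ S, (↑η : Set (Sym2 (Fin n))) ∈ openConnIn (({o} : Set (Fin n))ᶜ) a₀ a) ↔
          ¬ Disjoint S C := by
        rw [Finset.not_disjoint_iff]
        refine exists_congr (fun a => and_congr_right (fun haS => ?_))
        rw [hC, Finset.mem_filter]
        exact ⟨fun h => ⟨hSA haS, h⟩, fun h => h.2⟩
      have hSL : (∃ a ∈ S, (↑η : Set (Sym2 (Fin n))) ∈ openConnIn (({o} : Set (Fin n))ᶜ) a b) ↔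
          ¬ Disjoint S L := by
        rw [Finset.not_disjoint_iff]
        refine exists_congr (fun a => and_congr_right (fun haS => ?_))
        rw [hL, Finset.mem_filter]
        exact ⟨fun h => ⟨hSA haS, h⟩, fun h => h.2⟩
      by_cases hconn : ((↑(S.image (fun a => s(o, a))) ∪ ↑η : Set (Sym2 (Fin n))) ∈
          (openConn a₀ b : Set (BondConfig (Fin n))))
      · rw [if_neg (Set.notMem_compl_iff.2 hconn), mul_zero]
        rcases hiff.1 hconn with h | ⟨h1, h2⟩
        · exact absurd h hab
        · rw [if_neg (hSC.1 h1), if_neg (hSL.1 h2),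
            if_neg (fun h => hSC.1 h1 (Finset.disjoint_union_right.1 h).1), add_zero, sub_zero]
      · rw [if_pos (Set.mem_compl hconn), mul_one]
        have hnot : ¬ ((∃ a ∈ S, (↑η : Set (Sym2 (Fin n))) ∈ openConnIn (({o} : Set (Fin n))ᶜ) a₀ a) ∧
            (∃ a ∈ S, (↑η : Set (Sym2 (Fin n))) ∈ openConnIn (({o} : Set (Fin n))ᶜ) a b)) :=
          fun h => hconn (hiff.2 (Or.inr h))
        by_cases h1 : Disjoint S C
        · by_cases h2 : Disjoint S L
          · rw [if_pos h1, if_pos h2, if_pos (Finset.disjoint_union_right.2 ⟨h1, h2⟩)]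
            ring
          · rw [if_pos h1, if_neg h2, if_neg (fun h => h2 (Finset.disjoint_union_right.1 h).2),
              add_zero, sub_zero]
        · by_cases h2 : Disjoint S L
          · rw [if_neg h1, if_pos h2, if_neg (fun h => h1 (Finset.disjoint_union_right.1 h).1),
              zero_add, sub_zero]
          · exact absurd ⟨hSC.2 h1, hSL.2 h2⟩ hnot
    -- Step 2: coin algebra.
    rw [hsum, Finset.sum_sub_distrib, Finset.sum_add_distrib, starBF_coinExpansion_disjoint A C q,
      starBF_coinExpansion_disjoint A L q, starBF_coinExpansion_disjoint A (C ∪ L) q,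
      Finset.prod_filter, Finset.prod_filter, Finset.prod_filter]
    congr 1
    rw [← Finset.prod_mul_distrib]
    refine Finset.prod_congr rfl (fun a _ => ?_)
    by_cases h1 : a ∈ C
    · have h2 : a ∉ L := fun h2 => hCL a ⟨h1, h2⟩
      rw [if_pos (Finset.mem_union_left L h1), if_pos h1, if_neg h2, mul_one]
    · by_cases h2 : a ∈ L
      · rw [if_pos (Finset.mem_union_right C h2), if_neg h1, if_pos h2, one_mul]
      · rw [if_neg (fun h => (Finset.mem_union.1 h).elim h1 h2), if_neg h1, if_neg h2, mul_one]

end Summit.CriticalPhenomena.PercolationContinuityZ3.Theorems
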